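import Literature.Probability.LatticeModels.ModifiedSimonInequality
import Literature.Probability.LatticeModels.CriticalTwoPointDCPLowerTorus
import Literature.Probability.LatticeModels.SharpnessProofs
import HarnessLib

/-!
# RobustBall/IsingStarDecay — two-point decay of the nearest-neighbour Ising model on a TRIANGLE-FREE graph of maximal degree `Δ`
# BEYOND the single-site (Dobrushin) radius: `⟨σ_a σ_z⟩ ≤ (Δ(Δ−1) tanh²β)^{⌊ℓ(a)/2⌋}` (Simon–Lieb with STARS)

HONEST FRAMING: venture file of the cell `pub-ymgap` (QuantumFields programme), track Y2 ROBUST-BALL / DS seat ds-4 (g9).  A finite-volume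
statement about the classical Ising model (free boundary condition, zero field, `β ≥ 0`) on an arbitrary finite TRIANGLE-FREE graph with degrees
`≤ Δ`; written to move the `β`-window of the centre-projected `ℤ₂` layer of `SU(2)` lattice gauge theory (the centre-blind class of
ROBUST-BALL-STATEMENT §6(c)) past the single-site Dobrushin radius `2(d−1)·tanh β < 1` to the STAR radius `2(d−1)(2d−3)·tanh²β < 1`.  Nothing
about the continuum; no claim beyond the displayed inequality.

WHAT.  Let `G` be triangle-free with all degrees `≤ Δ`, `Λ` a finite volume, `β ≥ 0`, and `ℓ : V → ℕ` any function that is `1`-Lipschitz along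
edges with `ℓ z = 0` (e.g. a graph or coordinate distance to `z`).  Then for every `a ∈ Λ` with `ℓ a ≥ 2n`:
`⟨σ_a σ_z⟩^∅_{Λ;β} ≤ (Δ(Δ−1) tanh²β)^n` (`isingTwoPoint_free_le_starConst_pow`).  MECHANISM (Simon 1980 / Lieb 1980 in the finite-volume
`tanh` form of Duminil-Copin–Tassion 2016, Lemma 2.7 = the tree's `isingTwoPoint_free_le_modifiedSimon`, applied with the STAR `S_a = {a} ∪ N_Λ(a)`):
(i) inside the star, the same inequality with inner set `{x}` (a leaf) gives `⟨σ_aσ_x⟩_{S_a} ≤ tanh β` because, `G` being triangle-free, the only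
neighbour of `x` in `S_a` is `a` (`isingTwoPoint_star_leaf_le`); (ii) hence `φ_β(S_a) ≤ Δ(Δ−1) tanh²β` and every exit point of the star is two
`ℓ`-steps closer to nothing worse than `ℓ − 2`; (iii) induction on `n` (GKS I for the signs).  With `S = {a}` the same scheme only returns the
Dobrushin-type rate `Δ tanh β`; the star is the first rung of the Simon–Lieb ladder `S = B_r(a)`, `r = 1, 2, …` (larger balls need a computed
certificate for `⟨σ_aσ_x⟩_{B_r}`; not here).

References: B. Simon, Comm. Math. Phys. 77 (1980) 111, Thm. 2.1; E. Lieb, Comm. Math. Phys. 77 (1980) 127; H. Duminil-Copin, V. Tassion,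
Comm. Math. Phys. 343 (2016) 725, Lemma 2.7 [DuminilCopinTassionCMP2016]; Friedli–Velenik 2017 §3.6–3.8 (GKS).
-/

noncomputable section

open Finset
open Literature.Probability.LatticeModels

namespace Summit.Ventures.YMGap.RobustBall

namespace IsingStar

variable {V : Type*} [DecidableEq V] (G : SimpleGraph V) [G.LocallyFinite] [DecidableRel G.Adj]

/-- The STAR of `a` inside `Λ`: `a` and its neighbours in `Λ`. [folklore] -/
def star (Λ : Finset V) (a : V) : Finset V := insert a (Λ.filter (G.Adj a))

omit [G.LocallyFinite] in
/-- Membership in the star. [folklore] -/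
theorem mem_star {Λ : Finset V} {a x : V} : x ∈ star G Λ a ↔ x = a ∨ (x ∈ Λ ∧ G.Adj a x) := by
  simp [star]

omit [G.LocallyFinite] in
/-- The star lies in the volume (for `a ∈ Λ`). [folklore] -/
theorem star_subset {Λ : Finset V} {a : V} (ha : a ∈ Λ) : star G Λ a ⊆ Λ := by
  intro x hx
  rcases (mem_star G).1 hx with rfl | ⟨hx, -⟩
  · exact ha
  · exact hx

omit [G.LocallyFinite] in
/-- The centre is in its star. [folklore] -/
theorem mem_star_self (Λ : Finset V) (a : V) : a ∈ star G Λ a := mem_insert_self _ _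

/-- **Inside a star of a triangle-free graph, a leaf correlates with the centre by at most `tanh β`**:
`⟨σ_a σ_x⟩^∅_{S_a;β} ≤ tanh β` for `x ∈ Λ`, `x ∼ a` (modified Simon with inner set `{x}`: the only neighbour of `x` in the star is `a`).
[cite: DuminilCopinTassionCMP2016, Lemma 2.7] -/
theorem isingTwoPoint_star_leaf_le {β : ℝ} (hβ : 0 ≤ β) (htri : ∀ a x y, G.Adj a x → G.Adj a y → ¬G.Adj x y)
    {Λ : Finset V} {a x : V} (hx : x ∈ Λ) (hax : G.Adj a x) :
    isingTwoPoint G (star G Λ a) β 0 .free a x ≤ Real.tanh β := by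
  have hxS : x ∈ star G Λ a := (mem_star G).2 (Or.inr ⟨hx, hax⟩)
  have hxa : x ≠ a := hax.ne.symm
  have haS : a ∈ star G Λ a := mem_star_self G Λ a
  have hax' : a ∉ ({x} : Finset V) := by simpa using hxa.symm
  rw [show isingTwoPoint G (star G Λ a) β 0 .free a x = isingTwoPoint G (star G Λ a) β 0 .free x a by
    unfold isingTwoPoint spinPair; congr 1; funext σ; ring]
  refine (isingTwoPoint_free_le_modifiedSimon G hβ (S := {x}) (singleton_subset_iff.2 hxS) (mem_singleton_self x)
    haS hax').trans ?_
  rw [sum_singleton]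
  -- the exit set of `{x}` inside the star is `{a}`
  have hexit : (star G Λ a \ {x}).filter (G.Adj x) = {a} := by
    ext y
    simp only [mem_filter, mem_sdiff, mem_singleton, mem_star]
    constructor
    · rintro ⟨⟨hy | ⟨-, hay⟩, hyx⟩, hxy⟩
      · exact hy
      · exact absurd hxy (htri a x y hax hay)
    · rintro rfl
      exact ⟨⟨Or.inl rfl, hxa.symm⟩, hax.symm⟩
  rw [hexit, sum_singleton, isingTwoPoint_self, isingTwoPoint_self, mul_one, mul_one]

/-- **TWO-POINT DECAY ON A TRIANGLE-FREE GRAPH OF DEGREE `≤ Δ`, STAR RATE** (`β ≥ 0`): for `ℓ : V → ℕ` `1`-Lipschitz along edges with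
`ℓ z = 0`, `z ∈ Λ`, and every `a ∈ Λ` with `2n ≤ ℓ a`: `⟨σ_a σ_z⟩^∅_{Λ;β} ≤ (Δ(Δ−1) tanh²β)^n`.
[cite: DuminilCopinTassionCMP2016, Lemma 2.7] -/
theorem isingTwoPoint_free_le_starConst_pow {β : ℝ} (hβ : 0 ≤ β) {Δ : ℕ} (hdeg : ∀ x, (G.neighborFinset x).card ≤ Δ)
    (htri : ∀ a x y, G.Adj a x → G.Adj a y → ¬G.Adj x y) {Λ : Finset V} (ℓ : V → ℕ)
    (hℓ : ∀ x y, G.Adj x y → ℓ x ≤ ℓ y + 1) {z : V} (hz : ℓ z = 0) (hzΛ : z ∈ Λ) :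
    ∀ (n : ℕ) (a : V), a ∈ Λ → 2 * n ≤ ℓ a →
      isingTwoPoint G Λ β 0 .free a z ≤ ((Δ : ℝ) * ((Δ : ℝ) - 1) * Real.tanh β ^ 2) ^ n := by
  have ht0 : 0 ≤ Real.tanh β := by
    rw [Real.tanh_eq_sinh_div_cosh]; exact div_nonneg (Real.sinh_nonneg_iff.2 hβ) (Real.cosh_pos β).le
  intro n
  induction n with
  | zero =>
      intro a _ _
      rw [pow_zero]
      exact (le_abs_self _).trans (abs_isingTwoPoint_le_one G Λ β 0 .free a z)
  | succ n ih =>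
      intro a ha hna
      set S := star G Λ a with hS
      set φ₀ : ℝ := (Δ : ℝ) * ((Δ : ℝ) - 1) * Real.tanh β ^ 2 with hφ₀
      -- `z` is outside the star: `ℓ a ≥ 2`
      have hzS : z ∉ S := by
        intro hzS'
        rcases (mem_star G).1 hzS' with rfl | ⟨-, haz⟩
        · omega
        · have := hℓ a z haz; omega
      refine (isingTwoPoint_free_le_modifiedSimon G hβ (star_subset G ha) (mem_star_self G Λ a) hzΛ hzS).trans ?_
      -- bound each term: centre terms are absent, leaf terms are `≤ tanh β · tanh β · φ₀^n`
      have hterm : ∀ x ∈ S, ∑ y ∈ (Λ \ S).filter (G.Adj x),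
          Real.tanh β * isingTwoPoint G S β 0 .free a x * isingTwoPoint G Λ β 0 .free y z ≤
            if x = a then 0 else ((Δ : ℝ) - 1) * (Real.tanh β ^ 2 * φ₀ ^ n) := by
        intro x hxS
        split_ifs with hxa
        · -- no neighbour of the centre lies outside the star
          subst hxa
          refine (sum_eq_zero fun y hy => ?_).le
          exfalso
          rw [mem_filter, mem_sdiff] at hy
          exact hy.1.2 ((mem_star G).2 (Or.inr ⟨hy.1.1, hy.2⟩))
        · obtain ⟨hxΛ, hax⟩ : x ∈ Λ ∧ G.Adj a x := by
            rcases (mem_star G).1 hxS with h | h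
            · exact absurd h hxa
            · exact h
          have hleaf : isingTwoPoint G S β 0 .free a x ≤ Real.tanh β := isingTwoPoint_star_leaf_le G hβ htri hxΛ hax
          have hleaf0 : 0 ≤ isingTwoPoint G S β 0 .free a x :=
            DCPLower.isingTwoPoint_free_nonneg_of_mem G hβ (mem_star_self G Λ a) hxS
          -- each exit point `y` is `≥ ℓ a − 2 ≥ 2n` away
          have hy_bound : ∀ y ∈ (Λ \ S).filter (G.Adj x), isingTwoPoint G Λ β 0 .free y z ≤ φ₀ ^ n := by
            intro y hy
            rw [mem_filter, mem_sdiff] at hy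
            have h1 := hℓ a x hax
            have h2 := hℓ x y hy.2
            exact ih y hy.1.1 (by omega)
          have hy0 : ∀ y ∈ (Λ \ S).filter (G.Adj x), 0 ≤ isingTwoPoint G Λ β 0 .free y z := fun y hy =>
            DCPLower.isingTwoPoint_free_nonneg_of_mem G hβ (mem_sdiff.1 (mem_filter.1 hy).1).1 hzΛ
          -- the exit set has at most `Δ − 1` points (`a` is a neighbour of `x` inside the star)
          have hcard : (((Λ \ S).filter (G.Adj x)).card : ℝ) ≤ (Δ : ℝ) - 1 := by
            have hsub : (Λ \ S).filter (G.Adj x) ⊆ (G.neighborFinset x).erase a := by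
              intro y hy
              rw [mem_filter, mem_sdiff] at hy
              refine mem_erase.2 ⟨fun h => hy.1.2 (h ▸ mem_star_self G Λ a), ?_⟩
              rw [SimpleGraph.mem_neighborFinset]; exact hy.2
            have haN : a ∈ G.neighborFinset x := by rw [SimpleGraph.mem_neighborFinset]; exact hax.symm
            have h := card_le_card hsub
            rw [card_erase_of_mem haN] at h
            have hΔ := hdeg x
            have hpos : 1 ≤ (G.neighborFinset x).card := card_pos.2 ⟨a, haN⟩
            have : ((Λ \ S).filter (G.Adj x)).card + 1 ≤ Δ := by omega
            have : ((((Λ \ S).filter (G.Adj x)).card : ℕ) : ℝ) + 1 ≤ (Δ : ℝ) := by exact_mod_cast this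
            linarith
          calc ∑ y ∈ (Λ \ S).filter (G.Adj x), Real.tanh β * isingTwoPoint G S β 0 .free a x * isingTwoPoint G Λ β 0 .free y z
              ≤ ∑ _y ∈ (Λ \ S).filter (G.Adj x), Real.tanh β * Real.tanh β * φ₀ ^ n := by
                refine sum_le_sum fun y hy => ?_
                have := hy_bound y hy
                have := hy0 y hy
                gcongr
            _ = (((Λ \ S).filter (G.Adj x)).card : ℝ) * (Real.tanh β ^ 2 * φ₀ ^ n) := by
                rw [sum_const, nsmul_eq_mul]; ring
            _ ≤ ((Δ : ℝ) - 1) * (Real.tanh β ^ 2 * φ₀ ^ n) := by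
                have hφn : 0 ≤ φ₀ ^ n := by
                  refine pow_nonneg ?_ n
                  have hφpos : 0 ≤ (Δ : ℝ) * ((Δ : ℝ) - 1) := by
                    rcases Nat.eq_zero_or_pos Δ with h0 | hpos
                    · simp [h0]
                    · have : (1 : ℝ) ≤ Δ := by exact_mod_cast hpos
                      nlinarith
                  exact mul_nonneg hφpos (sq_nonneg _)
                exact mul_le_mul_of_nonneg_right hcard (mul_nonneg (sq_nonneg _) hφn)
      refine (sum_le_sum hterm).trans ?_
      -- at most `Δ` leaves
      rw [sum_ite, sum_const_zero, zero_add, sum_const, nsmul_eq_mul]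
      have hleaves : ((S.filter fun x => ¬x = a).card : ℝ) ≤ Δ := by
        have hsub : S.filter (fun x => ¬x = a) ⊆ G.neighborFinset a := by
          intro x hx
          rw [mem_filter] at hx
          rcases (mem_star G).1 hx.1 with h | ⟨-, h⟩
          · exact absurd h hx.2
          · rw [SimpleGraph.mem_neighborFinset]; exact h
        exact_mod_cast (card_le_card hsub).trans (hdeg a)
      have hφn : 0 ≤ Real.tanh β ^ 2 * φ₀ ^ n := by
        refine mul_nonneg (sq_nonneg _) (pow_nonneg ?_ n)
        have hφpos : 0 ≤ (Δ : ℝ) * ((Δ : ℝ) - 1) := by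
          rcases Nat.eq_zero_or_pos Δ with h0 | hpos
          · simp [h0]
          · have : (1 : ℝ) ≤ Δ := by exact_mod_cast hpos
            nlinarith
        exact mul_nonneg hφpos (sq_nonneg _)
      have hΔ1 : 0 ≤ (Δ : ℝ) - 1 ∨ (S.filter fun x => ¬x = a).card = 0 := by
        rcases Nat.eq_zero_or_pos Δ with h0 | hpos
        · right
          have hsub : S.filter (fun x => ¬x = a) ⊆ G.neighborFinset a := by
            intro x hx
            rw [mem_filter] at hx
            rcases (mem_star G).1 hx.1 with h | ⟨-, h⟩
            · exact absurd h hx.2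
            · rw [SimpleGraph.mem_neighborFinset]; exact h
          have := (card_le_card hsub).trans (hdeg a)
          omega
        · left
          have : (1 : ℝ) ≤ Δ := by exact_mod_cast hpos
          linarith
      rcases hΔ1 with hΔ1 | h0
      · calc ((S.filter fun x => ¬x = a).card : ℝ) * (((Δ : ℝ) - 1) * (Real.tanh β ^ 2 * φ₀ ^ n))
            ≤ (Δ : ℝ) * (((Δ : ℝ) - 1) * (Real.tanh β ^ 2 * φ₀ ^ n)) :=
              mul_le_mul_of_nonneg_right hleaves (mul_nonneg hΔ1 hφn)
          _ = φ₀ ^ (n + 1) := by rw [hφ₀]; ring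
      · rw [h0, Nat.cast_zero, zero_mul]
        exact pow_nonneg (mul_nonneg (by
          rcases Nat.eq_zero_or_pos Δ with h0' | hpos
          · simp [h0']
          · have : (1 : ℝ) ≤ Δ := by exact_mod_cast hpos
            nlinarith) (sq_nonneg _)) _

end IsingStar

end Summit.Ventures.YMGap.RobustBall

end
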